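import Literature.NumberTheory.Automorphic.ArchEndoscopicChartTorusRange   -- §1: `exists_endoTorus_eq_iff`, `chartTorusH_eq_range`, `mem_chartTorusH_iff`
import Literature.MeasureTheory.Group.InvariantQuotientNormalized           -- ★ `eq_unfoldingConstant_smul_quotientMeasure`, `lintegral_fiberLIntegral_quotientMeasure` (Weil with constant one)
import Mathlib.Topology.Baire.Lemmas
import Mathlib.Topology.Baire.LocallyCompactRegular
import HarnessLib

/-!
# The box of the chart torus has positive Haar mass; `chartOrbH` does not depend on the Haar measure
# (the second THEOREMS file behind PACK-SPEC (δ3): Folland 1995 §2.2, §2.6; Deitmar–Echterhoff 2014 Thm. 1.5.3; Rogawski 1990 §8.2)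

Topic `NumberTheory/Automorphic`; namespace `Literature.NumberTheory.Automorphic.UnitaryGroup`.  THEOREMS ONLY (no `def`, no instance, no notation, no axiom, no named
fact, no `sorry`).  Cell `pub/hodgecm-mathlib`, crux H413 (`stmt-HodgeConjecture-24833`), F0∕P3c line LH3 (closer stub `stub_N9`, DIRECT ROAD); sibling of ★ p849670
`ArchEndoscopicChartMeasures` ((T-MEAS), LH2-p04 (g3)) and of `ArchEndoscopicChartTorusRange` (the range of the chart is closed, `chartTorusH S =` range).

* §2 the closed coordinate box is a FUNDAMENTAL box: `exists_sub_mem_chartBox` (subtract the `⌊·⌋`-lattice point), so the countably many lattice translates of the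
  box image `B_S` cover `T_S` (`iUnion_smul_chartBoxImg_eq_univ`); `T_S` is locally compact Hausdorff, hence Baire ⇒ **`nonempty_interior_chartBoxImg`** ⇒
  **`measure_chartBoxImg_pos`** for every measure positive on opens, in particular **`chartHaarH_chartBoxImg_pos`**, `toReal_chartHaarH_chartBoxImg_pos`: the prefactor
  of ★ `chartOrbH` is a genuine positive real.
* §3 **`chartOrbH_eq_of_isHaarMeasure`** — HAAR-FREENESS of the chart orbital functional: for ANY inversion-invariant Haar measure `t` on `T_S` and a Haar `νH`,
  `chartOrbH νH S fH c = t(B_S) · ∫ fH (y endoTorus S c y⁻¹) d(νH ∕ t)(ȳ)`: by uniqueness `t = κ • dt_S`, the fibre integrals scale by `κ`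
  (`fiberLIntegral_eq_smul_of_eq_smul`), so Weil's formula with constant one (★ `lintegral_fiberLIntegral_quotientMeasure`) and ★ `eq_unfoldingConstant_smul_quotientMeasure`
  give `νH ∕ t = κ⁻¹ • (νH ∕ dt_S)` (**`quotientMeasure_eq_inv_smul_of_eq_smul`**, generic), and `κ · κ⁻¹ = 1`.  So the (CUR-chart) junction may plug the frame's
  transported torus measure `tH` straight in, and the `G′`-twin with the SAME box is coherent with no hidden constant.
HONEST LABEL: HC_CM is proved only modulo the 7 printed citations (2 remaining: hLiu418 = `stmt-HodgeConjecture-24832`, h413 = `stmt-HodgeConjecture-24833`) until rung 0 closes;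
count-neutral.

## References
* [Folland1995] G. B. Folland, *A Course in Abstract Harmonic Analysis* (1995), §2.2 (Haar measure: uniqueness, positivity on sets with interior), §2.6 Thm. 2.49, (2.52).
* [DeitmarEchterhoff2014] A. Deitmar, S. Echterhoff, *Principles of Harmonic Analysis*, 2nd ed. (2014), Thm. 1.5.3.
* [Rogawski1990] J. D. Rogawski, *Automorphic Representations of Unitary Groups in Three Variables*, Ann. of Math. Stud. 123 (1990), §8.2 p. 122.
-/

set_option autoImplicit false

noncomputable section

open MeasureTheory MeasureTheory.Measure NumberField NumberField.InfinitePlace Matrix Complex Topology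
open Literature.MeasureTheory.Group
open scoped MatrixGroups Matrix ComplexConjugate Classical ENNReal NNReal Pointwise

namespace Literature.NumberTheory.Automorphic.UnitaryGroup

open Literature.NumberTheory.Rogawski1990

/-! ### §2 The box is fundamental: lattice translates cover `T_S`; Baire ⇒ nonempty interior ⇒ positive Haar mass -/

section Box

variable (L : Type) [Field L] [NumberField L] [IsCMField L] (S : Finset {w : InfinitePlace L // IsComplex w})

omit [NumberField L] [IsCMField L] in
/-- **The closed coordinate box is a fundamental box for the period lattice**: every coordinate vector differs from some lattice vector (`ℤ` in the `x`-slots,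
`2πℤ` in the angle slots) by a box vector (subtract `⌊c ∕ period⌋ · period`). [cite: Folland1995, §2.2] -/
theorem exists_sub_mem_chartBox (c : {w : InfinitePlace L // IsComplex w} → Fin 3 → ℝ) :
    ∃ n : {w : InfinitePlace L // IsComplex w} → Fin 3 → ℤ,
      (c - fun w i => (n w i : ℝ) * (if w ∈ S ∧ i = 0 then 1 else 2 * Real.pi)) ∈ chartBox L S := by
  refine ⟨fun w i => ⌊c w i / (if w ∈ S ∧ i = 0 then 1 else 2 * Real.pi)⌋, fun w _ i _ => ?_⟩
  set p : ℝ := if w ∈ S ∧ i = 0 then 1 else 2 * Real.pi with hp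
  have hp0 : 0 < p := by rw [hp]; split_ifs; exacts [one_pos, by positivity]
  have hfr : c w i - (⌊c w i / p⌋ : ℝ) * p = p * Int.fract (c w i / p) := by
    rw [Int.fract, mul_sub, mul_div_cancel₀ _ hp0.ne']
    ring
  simp only [Pi.sub_apply, Set.mem_Icc]
  rw [hfr]
  exact ⟨mul_nonneg hp0.le (Int.fract_nonneg _), by nlinarith [Int.fract_lt_one (c w i / p)]⟩

/-- **The lattice translates of the box image cover `T_S`.** [cite: Folland1995, §2.2] -/
theorem iUnion_smul_chartBoxImg_eq_univ :
    (⋃ n : {w : InfinitePlace L // IsComplex w} → Fin 3 → ℤ,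
      (⟨endoTorus L S (fun w i => (n w i : ℝ) * (if w ∈ S ∧ i = 0 then 1 else 2 * Real.pi)), endoTorus_mem_chartTorusH L S _⟩ : ↥(chartTorusH L S)) •
        chartBoxImg L S) = Set.univ := by
  refine Set.eq_univ_of_forall fun t => ?_
  obtain ⟨c, hc⟩ := (mem_chartTorusH_iff L S t.1).mp t.2
  obtain ⟨n, hn⟩ := exists_sub_mem_chartBox L S c
  refine Set.mem_iUnion.mpr ⟨n, ?_⟩
  refine ⟨⟨endoTorus L S (c - fun w i => (n w i : ℝ) * (if w ∈ S ∧ i = 0 then 1 else 2 * Real.pi)), endoTorus_mem_chartTorusH L S _⟩,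
    ⟨_, hn, rfl⟩, ?_⟩
  apply Subtype.ext
  show endoTorus L S _ * endoTorus L S _ = t.1
  rw [← endoTorus_add, add_sub_cancel, hc]

/-- **THE BOX IMAGE HAS NONEMPTY INTERIOR IN `T_S`** (Baire: countably many closed translates cover the locally compact Hausdorff `T_S`). [cite: Folland1995, §2.2] -/
theorem nonempty_interior_chartBoxImg : (interior (chartBoxImg L S)).Nonempty := by
  haveI := locallyCompactSpace_chartTorusH L S
  obtain ⟨n, hn⟩ := nonempty_interior_of_iUnion_of_closed (fun n => ((isCompact_chartBoxImg L S).smul _).isClosed) (iUnion_smul_chartBoxImg_eq_univ L S)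
  rw [interior_smul] at hn
  exact Set.smul_set_nonempty.mp hn

variable
  [MeasurableSpace (↥(arch (↥(maximalRealSubfield L)) L (IsCMField.complexConj L) 2 (Matrix.of fun i j : Fin 2 => if i.val + j.val + 1 = 2 then (1 : L) else 0)) ×
      ↥(arch (↥(maximalRealSubfield L)) L (IsCMField.complexConj L) 1 (Matrix.of fun i j : Fin 1 => if i.val + j.val + 1 = 1 then (1 : L) else 0)))]

/-- **Every measure positive on open sets gives the box image positive mass** — in particular every Haar measure on `T_S`. [cite: Folland1995, §2.2] -/
theorem measure_chartBoxImg_pos (t : Measure ↥(chartTorusH L S)) [t.IsOpenPosMeasure] : 0 < t (chartBoxImg L S) :=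
  t.measure_pos_of_nonempty_interior (nonempty_interior_chartBoxImg L S)

variable
  [BorelSpace (↥(arch (↥(maximalRealSubfield L)) L (IsCMField.complexConj L) 2 (Matrix.of fun i j : Fin 2 => if i.val + j.val + 1 = 2 then (1 : L) else 0)) ×
      ↥(arch (↥(maximalRealSubfield L)) L (IsCMField.complexConj L) 1 (Matrix.of fun i j : Fin 1 => if i.val + j.val + 1 = 1 then (1 : L) else 0)))]

/-- **`0 < dt_S(B_S) < ∞`: the prefactor of ★ `chartOrbH` is a genuine positive real.** [cite: Folland1995, §2.2] -/
theorem chartHaarH_chartBoxImg_pos : 0 < chartHaarH L S (chartBoxImg L S) :=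
  haveI := isOpenPosMeasure_chartHaarH L S
  measure_chartBoxImg_pos L S _

/-- The prefactor as a real number is positive. [cite: Folland1995, §2.2] -/
theorem toReal_chartHaarH_chartBoxImg_pos : 0 < (chartHaarH L S (chartBoxImg L S)).toReal :=
  ENNReal.toReal_pos (chartHaarH_chartBoxImg_pos L S).ne' (chartHaarH_chartBoxImg_lt_top L S).ne

end Box


/-! ### §3 Haar-freeness of the chart orbital functional -/

section Free

/-- Fibre integrals scale with the fibre measure: `fiberLIntegral H ρ₂ f = κ · fiberLIntegral H ρ₁ f` when `ρ₂ = κ • ρ₁`. [cite: Folland1995, §2.6 (2.52)] -/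
theorem fiberLIntegral_eq_smul_of_eq_smul {G : Type*} [Group G] [MeasurableSpace G] (H : Subgroup G) [MeasurableMul H]
    (ρ₁ ρ₂ : Measure H) [ρ₁.IsMulLeftInvariant] [ρ₂.IsMulLeftInvariant] {κ : ℝ≥0} (h : ρ₂ = κ • ρ₁) (f : G → ℝ≥0∞) (x : G ⧸ H) :
    fiberLIntegral H ρ₂ f x = κ * fiberLIntegral H ρ₁ f x := by
  induction x using QuotientGroup.induction_on with
  | H g => rw [fiberLIntegral_mk, fiberLIntegral_mk, h, lintegral_smul_measure, ENNReal.smul_def, smul_eq_mul]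

/-- **QUOTIENT MEASURES SCALE INVERSELY WITH THE FIBRE HAAR MEASURE**: if `ρ₂ = κ • ρ₁` (`κ ≠ 0`) are Haar measures on the closed subgroup `H`, then
`ν ∕ ρ₂ = κ⁻¹ • (ν ∕ ρ₁)` for the ★ `quotientMeasure`s (Weil's formula with constant one for `ρ₂`, ★ `lintegral_fiberLIntegral_quotientMeasure`, against the
unfolding identity for `ρ₁`, ★ `eq_unfoldingConstant_smul_quotientMeasure`, tested on a positive compact).  Generic; stated here for the chart tori.
[cite: DeitmarEchterhoff2014, Thm. 1.5.3] [cite: Folland1995, §2.6 Thm. 2.49, (2.52)] -/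
theorem quotientMeasure_eq_inv_smul_of_eq_smul {G : Type*} [Group G] [TopologicalSpace G] [IsTopologicalGroup G] [LocallyCompactSpace G]
    [SecondCountableTopology G] [T2Space G] [MeasurableSpace G] [BorelSpace G]
    (H : Subgroup G) (hH : IsClosed (H : Set G)) [MeasurableSpace (G ⧸ H)] [BorelSpace (G ⧸ H)]
    (ρ₁ ρ₂ : Measure H) [ρ₁.IsHaarMeasure] [ρ₁.IsInvInvariant] [ρ₂.IsHaarMeasure] [ρ₂.IsInvInvariant]
    (ν : Measure G) [ν.IsHaarMeasure] [ν.IsMulRightInvariant] {κ : ℝ≥0} (hκ : κ ≠ 0) (h : ρ₂ = κ • ρ₁) :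
    quotientMeasure H ρ₂ hH ν = κ⁻¹ • quotientMeasure H ρ₁ hH ν := by
  haveI : IsClosed (H : Set G) := hH
  -- the quotient measure of `ρ₂` is an invariant measure finite on compacts, hence a multiple of that of `ρ₁`
  have hQ := eq_unfoldingConstant_smul_quotientMeasure H ρ₁ ν (quotientMeasure H ρ₂ hH ν)
  -- compute the unfolding constant on a positive compact
  obtain ⟨K⟩ := (inferInstance : Nonempty (TopologicalSpace.PositiveCompacts G))
  have hKpos : 0 < ν K := measure_pos_of_nonempty_interior ν K.interior_nonempty
  have hKfin : ν K < ⊤ := K.isCompact.measure_lt_top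
  have hmeas : Measurable ((K : Set G).indicator (1 : G → ℝ≥0∞)) := measurable_one.indicator K.isCompact.measurableSet
  have h1 := lintegral_fiberLIntegral_quotientMeasure H ρ₂ ν hmeas
  have h2 := lintegral_fiberLIntegral_eq_mul_lintegral H ρ₁ (quotientMeasure H ρ₂ hH ν) ν hmeas
  have hfib : fiberLIntegral H ρ₂ ((K : Set G).indicator (1 : G → ℝ≥0∞)) = fun x => κ * fiberLIntegral H ρ₁ ((K : Set G).indicator (1 : G → ℝ≥0∞)) x :=
    funext fun x => fiberLIntegral_eq_smul_of_eq_smul H ρ₁ ρ₂ h _ x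
  rw [hfib, lintegral_const_mul' _ _ ENNReal.coe_ne_top, h2, lintegral_indicator_one K.isCompact.measurableSet] at h1
  -- `κ * (uC * ν K) = ν K` ⇒ `κ * uC = 1`
  have hprod : (κ : ℝ≥0∞) * (unfoldingConstant H ρ₁ (quotientMeasure H ρ₂ hH ν) ν : ℝ≥0∞) = 1 := by
    have h3 : ((κ : ℝ≥0∞) * (unfoldingConstant H ρ₁ (quotientMeasure H ρ₂ hH ν) ν : ℝ≥0∞)) * ν K = 1 * ν K := by
      rw [one_mul, mul_assoc]; exact h1
    exact (ENNReal.mul_left_inj hKpos.ne' hKfin.ne).mp h3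
  have huc : unfoldingConstant H ρ₁ (quotientMeasure H ρ₂ hH ν) ν = κ⁻¹ := by
    have h4 : (κ : ℝ≥0∞) * (unfoldingConstant H ρ₁ (quotientMeasure H ρ₂ hH ν) ν : ℝ≥0∞) = (κ : ℝ≥0∞) * (κ⁻¹ : ℝ≥0) := by
      rw [hprod, ENNReal.coe_inv hκ, ENNReal.mul_inv_cancel (ENNReal.coe_ne_zero.mpr hκ) ENNReal.coe_ne_top]
    have h5 := (ENNReal.mul_right_inj (ENNReal.coe_ne_zero.mpr hκ) ENNReal.coe_ne_top).mp h4
    exact_mod_cast h5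
  rw [huc] at hQ
  exact hQ

variable (L : Type) [Field L] [NumberField L] [IsCMField L] (S : Finset {w : InfinitePlace L // IsComplex w})
  [MeasurableSpace (↥(arch (↥(maximalRealSubfield L)) L (IsCMField.complexConj L) 2 (Matrix.of fun i j : Fin 2 => if i.val + j.val + 1 = 2 then (1 : L) else 0)) ×
      ↥(arch (↥(maximalRealSubfield L)) L (IsCMField.complexConj L) 1 (Matrix.of fun i j : Fin 1 => if i.val + j.val + 1 = 1 then (1 : L) else 0)))]
  [BorelSpace (↥(arch (↥(maximalRealSubfield L)) L (IsCMField.complexConj L) 2 (Matrix.of fun i j : Fin 2 => if i.val + j.val + 1 = 2 then (1 : L) else 0)) ×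
      ↥(arch (↥(maximalRealSubfield L)) L (IsCMField.complexConj L) 1 (Matrix.of fun i j : Fin 1 => if i.val + j.val + 1 = 1 then (1 : L) else 0)))]
  (νH : Measure (↥(arch (↥(maximalRealSubfield L)) L (IsCMField.complexConj L) 2 (Matrix.of fun i j : Fin 2 => if i.val + j.val + 1 = 2 then (1 : L) else 0)) ×
      ↥(arch (↥(maximalRealSubfield L)) L (IsCMField.complexConj L) 1 (Matrix.of fun i j : Fin 1 => if i.val + j.val + 1 = 1 then (1 : L) else 0))))
  [νH.IsHaarMeasure] [νH.IsMulRightInvariant]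

/-- **HAAR-FREENESS OF THE CHART ORBITAL FUNCTIONAL** (ruling (δ3)): for ANY inversion-invariant Haar measure `t` on the chart torus `T_S` (e.g. the frame's
transported torus measure `tH`) and a Haar measure `νH` on `H_∞`,
`chartOrbH νH S fH c = t(B_S) · ∫_{H_∞ ⧸ T_S} fH (y · endoTorus S c · y⁻¹) d(νH ∕ t)(ȳ)` — the auxiliary `chartHaarH` has disappeared.  (`t = κ • dt_S` by uniqueness,
`νH ∕ t = κ⁻¹ • (νH ∕ dt_S)` by `quotientMeasure_eq_inv_smul_of_eq_smul`, `κ κ⁻¹ = 1`.) [cite: Folland1995, §2.2; §2.6 Thm. 2.49] [cite: DeitmarEchterhoff2014, Thm. 1.5.3]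
[cite: Rogawski1990, §8.2 p. 122] -/
theorem chartOrbH_eq_of_isHaarMeasure (t : Measure ↥(chartTorusH L S)) [t.IsHaarMeasure] [t.IsInvInvariant]
    (fH : ↥(arch (↥(maximalRealSubfield L)) L (IsCMField.complexConj L) 2 (Matrix.of fun i j : Fin 2 => if i.val + j.val + 1 = 2 then (1 : L) else 0)) ×
      ↥(arch (↥(maximalRealSubfield L)) L (IsCMField.complexConj L) 1 (Matrix.of fun i j : Fin 1 => if i.val + j.val + 1 = 1 then (1 : L) else 0)) → ℂ)
    (c : {w : InfinitePlace L // IsComplex w} → Fin 3 → ℝ) :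
    chartOrbH L νH S fH c =
      (letI : MeasurableSpace ((↥(arch (↥(maximalRealSubfield L)) L (IsCMField.complexConj L) 2 (Matrix.of fun i j : Fin 2 => if i.val + j.val + 1 = 2 then (1 : L) else 0)) ×
          ↥(arch (↥(maximalRealSubfield L)) L (IsCMField.complexConj L) 1 (Matrix.of fun i j : Fin 1 => if i.val + j.val + 1 = 1 then (1 : L) else 0))) ⧸ chartTorusH L S) := borel _
       haveI : BorelSpace ((↥(arch (↥(maximalRealSubfield L)) L (IsCMField.complexConj L) 2 (Matrix.of fun i j : Fin 2 => if i.val + j.val + 1 = 2 then (1 : L) else 0)) ×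
          ↥(arch (↥(maximalRealSubfield L)) L (IsCMField.complexConj L) 1 (Matrix.of fun i j : Fin 1 => if i.val + j.val + 1 = 1 then (1 : L) else 0))) ⧸ chartTorusH L S) := ⟨rfl⟩
       ((t (chartBoxImg L S)).toReal : ℂ) *
         ∫ y, descConj (endoTorus L S c) (chartTorusH L S) (forall_mem_chartTorusH_comm L S c) fH y ∂(quotientMeasure (chartTorusH L S) t (isClosed_chartTorusH L S) νH)) := by
  letI : MeasurableSpace ((↥(arch (↥(maximalRealSubfield L)) L (IsCMField.complexConj L) 2 (Matrix.of fun i j : Fin 2 => if i.val + j.val + 1 = 2 then (1 : L) else 0)) ×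
      ↥(arch (↥(maximalRealSubfield L)) L (IsCMField.complexConj L) 1 (Matrix.of fun i j : Fin 1 => if i.val + j.val + 1 = 1 then (1 : L) else 0))) ⧸ chartTorusH L S) := borel _
  haveI : BorelSpace ((↥(arch (↥(maximalRealSubfield L)) L (IsCMField.complexConj L) 2 (Matrix.of fun i j : Fin 2 => if i.val + j.val + 1 = 2 then (1 : L) else 0)) ×
      ↥(arch (↥(maximalRealSubfield L)) L (IsCMField.complexConj L) 1 (Matrix.of fun i j : Fin 1 => if i.val + j.val + 1 = 1 then (1 : L) else 0))) ⧸ chartTorusH L S) := ⟨rfl⟩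
  haveI := locallyCompactSpace_chartTorusH L S
  haveI := isHaarMeasure_chartHaarH L S
  haveI := isInvInvariant_chartHaarH L S
  -- Haar uniqueness on the second countable locally compact group `T_S`
  set κ : ℝ≥0 := haarScalarFactor t (chartHaarH L S) with hκdef
  have hκ : κ ≠ 0 := (haarScalarFactor_pos_of_isHaarMeasure t (chartHaarH L S)).ne'
  have ht : t = κ • chartHaarH L S := isMulLeftInvariant_eq_smul t (chartHaarH L S)
  have hQ := quotientMeasure_eq_inv_smul_of_eq_smul (chartTorusH L S) (isClosed_chartTorusH L S) (chartHaarH L S) t νH hκ ht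
  rw [chartOrbH_def]
  show ((chartHaarH L S (chartBoxImg L S)).toReal : ℂ) *
      ∫ y, descConj (endoTorus L S c) (chartTorusH L S) (forall_mem_chartTorusH_comm L S c) fH y
        ∂(quotientMeasure (chartTorusH L S) (chartHaarH L S) (isClosed_chartTorusH L S) νH) = _
  rw [hQ, integral_smul_nnreal_measure, ht, Measure.smul_apply, ENNReal.smul_def, smul_eq_mul, ENNReal.toReal_mul, ENNReal.coe_toReal,
    NNReal.smul_def, Complex.real_smul, NNReal.coe_inv, Complex.ofReal_mul, Complex.ofReal_inv]
  have hκC : ((κ : ℝ) : ℂ) ≠ 0 := by exact_mod_cast hκ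
  field_simp

end Free

end Literature.NumberTheory.Automorphic.UnitaryGroup

end
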